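import Literature.NumberTheory.GaloisRepresentations.AbsGaloisGroup
import Mathlib.NumberTheory.NumberField.AdeleRing
import Mathlib.Topology.Instances.AddCircle.Defs
import HarnessLib

/-!
# Finite-order characters of a number field with prescribed components at finitely many places
# (Clozel–Harris–Taylor 2008, Lemma 4.1.1)

Topic `Literature/NumberTheory/GaloisRepresentations` (characters of absolute Galois groups of number
fields; vocabulary `Field.absoluteGaloisGroup`, the restriction `absGaloisRestrict F (v.adicCompletion F)`
to the decomposition group at a finite place `v` (`AbsGaloisGroup.lean`), locally constant additive
characters with values in `ℚ/ℤ = AddCircle (1 : ℚ)` — the tree's rendering of finite-order characters,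
cf. `TateLevelOneLocalCharacters.lean`, `TateH2VanishingCharacterCriterion.lean`).  ONE named fact
(D-0014, statement only), requested by the line `symmetrise-pd-split` of crux `stmt-Langlands-17000`
(`TwistedInductionParallel`): the symmetrising twist needs a finite-order character of `Γ_F` with
prescribed restriction to the decomposition groups at the two places above `p` (a "half-ramified
Teichmüller compensator", which class field theory supplies and nothing more elementary does).

L. Clozel, M. Harris, R. Taylor, *Automorphy for some l-adic lifts of automorphic mod l Galois
representations*, Publ. Math. IHÉS 108 (2008), §4.1 (held text `paper:doi-10-1007-s10240-008-0016-1`,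
p. 116, read 2026-08-17), **Lemma 4.1.1**, as printed:

> Suppose that `F` is a number field and that `S` is a finite set of places of `F`. Suppose also that
> `χ_S : ∏_{v ∈ S} F_vˣ → ℚ̄ˣ` is a continuous character of finite order. Then there is a continuous
> character `χ : Fˣ \ 𝔸_Fˣ → ℚ̄ˣ` such that `χ|_{∏_{v∈S} F_vˣ} = χ_S`.
> *Proof.* One may suppose that `S` contains all infinite places. Then we choose an open subgroup
> `U ⊂ (𝔸_F^S)ˣ` such that `χ_S` is trivial on `U ∩ Fˣ`. (This is possible as any finite index subgroup
> of `𝒪_Fˣ` is a congruence subgroup.) Then we can extend `χ_S` to `U ∏_{v∈S} F_vˣ / (U ∩ Fˣ)` by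
> setting it to one on `U`. Finally we can extend this character to `𝔸_Fˣ/Fˣ` (which contains
> `U ∏_{v∈S} F_vˣ/(U ∩ Fˣ)` as an open subgroup).

(The extended character has finite order: it is trivial on the open subgroup `U · ker χ_S ⊇ (F_∞ˣ)⁰`,
and `𝔸_Fˣ / Fˣ (F_∞ˣ)⁰ V` is a ray class group, finite, for every open `V`.)

## What is vendored: the Galois form, finite places

`ClozelHarrisTaylor2008.exists_character_restrict_eq`: for a number field `F`, a finite set `S` of FINITE
places and, for `v ∈ S`, locally constant additive characters `χ_v : Γ_{F_v} → ℚ/ℤ` (= continuous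
characters of finite order of the decomposition groups), there is a locally constant additive character
`ψ : Γ_F → ℚ/ℤ` with `ψ ∘ res_v = χ_v` for every `v ∈ S`.  TRANSPORT from the printed idelic statement
(special case: `S` finite places only): by the Artin reciprocity law the reciprocity map induces a
topological isomorphism of the profinite completion of `Fˣ\𝔸_Fˣ` with `Γ_F^{ab}` under which the
decomposition group of `v` is the image of `F_vˣ → Fˣ\𝔸_Fˣ` composed with the local reciprocity map,
itself an isomorphism of the profinite completion of `F_vˣ` with `Γ_{F_v}^{ab}` (Tate, *Global class
field theory*, in Cassels–Fröhlich, Ch. VII §5.1–5.5 and §6; Neukirch, *Algebraic Number Theory*,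
VI (5.5)–(5.6), (6.1)); so continuous finite-order characters of `Fˣ\𝔸_Fˣ`, resp. `F_vˣ`, are exactly the
continuous finite-order (= locally constant) characters of `Γ_F`, resp. `Γ_{F_v}`, compatibly with
restriction, and Lemma 4.1.1 becomes the statement below (equivalently: for finite `S`,
`H¹(F, ℚ/ℤ) → ⊕_{v∈S} H¹(F_v, ℚ/ℤ)` is surjective — no Grunwald–Wang exception, the orders being free).
-- TODO(idelic form): the printed statement for `χ_S` on `∏_{v∈S} F_vˣ`, `S` allowed to contain infinite
-- places, once the tree's global Artin map (`GlobalArtinMap*`) carries the local–global compatibility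
-- at ramified places; then this def is a corollary.

## References

* [ClozelHarrisTaylor2008] L. Clozel, M. Harris, R. Taylor, Publ. Math. IHÉS 108 (2008), Lemma 4.1.1
  (p. 116).
* [CasselsFrohlichANT1967] J. Tate, *Global class field theory*, Ch. VII of Cassels–Fröhlich (1967),
  §5.1–5.5, §6.
* [NeukirchANT1999] J. Neukirch, *Algebraic Number Theory* (1999), Ch. VI (5.5)–(5.6), (6.1).
-/

noncomputable section

open scoped NumberField
open NumberField IsDedekindDomain Field

namespace Literature.NumberTheory.GaloisRepresentations

namespace ClozelHarrisTaylor2008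

/-- **Clozel–Harris–Taylor 2008, Lemma 4.1.1 (Galois form, finite places)**, NAMED FACT.  For a number
field `F`, a finite set `S` of finite places of `F` and locally constant additive characters
`χ v : Γ_{F_v} → ℚ/ℤ` (`v ∈ S`; the data at `v ∉ S` are ignored), there is a locally constant additive
character `ψ : Γ_F → ℚ/ℤ` whose restriction to the decomposition group at every `v ∈ S` — along the
tree's `absGaloisRestrict F (v.adicCompletion F)` — is `χ v`.  Printed (idelic) statement and the
transport by Artin reciprocity are quoted in the module docstring.
[cite: ClozelHarrisTaylor2008, Lemma 4.1.1 (p. 116)] [cite: CasselsFrohlichANT1967, Ch. VII §5.1–5.5, §6 (Tate)] -/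
def exists_character_restrict_eq : Prop :=
  ∀ (F : Type) [Field F] [NumberField F] (S : Finset (HeightOneSpectrum (𝓞 F)))
    (χ : ∀ v : HeightOneSpectrum (𝓞 F), absoluteGaloisGroup (v.adicCompletion F) → AddCircle (1 : ℚ)),
    (∀ v ∈ S, IsLocallyConstant (χ v) ∧ ∀ σ τ, χ v (σ * τ) = χ v σ + χ v τ) →
    ∃ ψ : absoluteGaloisGroup F → AddCircle (1 : ℚ),
      IsLocallyConstant ψ ∧ (∀ σ τ, ψ (σ * τ) = ψ σ + ψ τ) ∧
      ∀ v ∈ S, ∀ σ : absoluteGaloisGroup (v.adicCompletion F),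
        ψ (absGaloisRestrict F (v.adicCompletion F) σ) = χ v σ

end ClozelHarrisTaylor2008

end Literature.NumberTheory.GaloisRepresentations

end
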